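import Mathlib.Analysis.Complex.Basic
import Mathlib.Topology.Algebra.Order.Field
import Mathlib.Topology.Order.LeftRight
import Mathlib.Analysis.Normed.Group.Bounded
import Summits.CriticalPhenomena.SAWScalingLimit.Theorems.SAWReversalUpgradeAttachmentExistsArcs

/-!
# The inverse boundary correspondence `ψ = Φ⁻¹` on `closure D ∖ {b}`, rays, and the fallback arc
# (route `SAWReversalUpgrade`, helper for item `AttachmentExists`, stmt-CriticalPhenomena-18009)

Abstract setting of the standard boundary attachment: a map `Φ : ℂ → ℂ` (in the application the
Carathéodory boundary extension of a chordal uniformizing map `(ℍ; 0, ∞) → (D; a, b)`) which is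
continuous and injective on the closed half-plane `ℍ̄ = {im ≥ 0}`, sends `0 ↦ a`, the open
half-plane into `D`, never takes the value `b` on `ℍ̄`, tends to `b` at infinity within `ℍ̄`, and
whose image of `ℍ̄` contains `closure D ∖ {b}`. We study the section
`ψ = Function.invFunOn Φ ℍ̄` (the `ψ₁` of the route statement):

* `inv_spec`, `inv_apply`, `inv_zero_pt`, `inv_eq_zero_iff`, `inv_injOn` — `ψ` is the inverse of
  `Φ|ℍ̄` on `closure D ∖ {b}`, with `ψ a = 0`;
* `inv_tendsto_cocompact` — `ψ p → ∞` as `p → b` (compactness);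
* `ray_tendsto`, `ray_tendsto_pt` — `Φ (r q) → b` as `r → ∞` along a ray of `ℍ̄`;
* `arcs_segment`, `arcs_ray` — the images of a segment `[0, s₀] · p` and of a closed ray
  `[r₀, ∞] · q` are (weak) arcs;
* `fallback_curve` — the fallback attachment `{a, b} ∪ Φ(i ℝ₊)` is an injective curve from `a` to
  `b` with interior in `D`.

Folklore point-set topology / complex analysis bookkeeping.
-/

noncomputable section

namespace Summit.CriticalPhenomena.SAWScalingLimit.Theorems

open Set Function Filter Topology
open scoped unitInterval

variable {Φ : ℂ → ℂ} {D : Set ℂ} {a b : ℂ}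

/-! ### The section `ψ = invFunOn Φ ℍ̄` -/

/-- `ψ p ∈ ℍ̄` and `Φ (ψ p) = p` on `closure D ∖ {b}`. [folklore] -/
theorem inv_spec (hsurj : closure D \ {b} ⊆ Φ '' {z : ℂ | 0 ≤ z.im}) {p : ℂ}
    (hp : p ∈ closure D \ {b}) :
    0 ≤ (invFunOn Φ {z : ℂ | 0 ≤ z.im} p).im ∧ Φ (invFunOn Φ {z : ℂ | 0 ≤ z.im} p) = p := by
  obtain ⟨z, hz, hzp⟩ := hsurj hp
  exact ⟨invFunOn_mem ⟨z, hz, hzp⟩, invFunOn_eq ⟨z, hz, hzp⟩⟩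

/-- `ψ (Φ z) = z` for `z ∈ ℍ̄`. [folklore] -/
theorem inv_apply (hinj : InjOn Φ {z : ℂ | 0 ≤ z.im}) {z : ℂ} (hz : 0 ≤ z.im) :
    invFunOn Φ {z : ℂ | 0 ≤ z.im} (Φ z) = z :=
  hinj.leftInvOn_invFunOn hz

/-- `ψ a = 0`. [folklore] -/
theorem inv_zero_pt (hinj : InjOn Φ {z : ℂ | 0 ≤ z.im}) (hΦ0 : Φ 0 = a) :
    invFunOn Φ {z : ℂ | 0 ≤ z.im} a = 0 := by
  rw [← hΦ0]
  exact inv_apply hinj (by simp)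

/-- `ψ p = 0 ↔ p = a` on `closure D ∖ {b}`. [folklore] -/
theorem inv_eq_zero_iff (hinj : InjOn Φ {z : ℂ | 0 ≤ z.im})
    (hsurj : closure D \ {b} ⊆ Φ '' {z : ℂ | 0 ≤ z.im}) (hΦ0 : Φ 0 = a) {p : ℂ}
    (hp : p ∈ closure D \ {b}) : invFunOn Φ {z : ℂ | 0 ≤ z.im} p = 0 ↔ p = a := by
  constructor
  · intro h
    rw [← (inv_spec hsurj hp).2, h, hΦ0]
  · rintro rfl
    exact inv_zero_pt hinj hΦ0

/-- `ψ` is injective on `closure D ∖ {b}` (it has the left inverse `Φ`). [folklore] -/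
theorem inv_injOn (hsurj : closure D \ {b} ⊆ Φ '' {z : ℂ | 0 ≤ z.im}) :
    InjOn (invFunOn Φ {z : ℂ | 0 ≤ z.im}) (closure D \ {b}) := by
  intro p hp q hq h
  rw [← (inv_spec hsurj hp).2, ← (inv_spec hsurj hq).2, h]

/-- **`ψ p → ∞` as `p → b` within `closure D ∖ {b}`**: the image under `Φ` of the compact set
`ℍ̄ ∩ B̄(0, R)` is a compact set missing `b`, hence misses a neighbourhood of `b`. [folklore] -/
theorem inv_tendsto_cocompact (hΦc : ContinuousOn Φ {z : ℂ | 0 ≤ z.im})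
    (hΦb : ∀ z : ℂ, 0 ≤ z.im → Φ z ≠ b) (hsurj : closure D \ {b} ⊆ Φ '' {z : ℂ | 0 ≤ z.im}) :
    Tendsto (invFunOn Φ {z : ℂ | 0 ≤ z.im}) (𝓝[closure D \ {b}] b) (cocompact ℂ) := by
  rw [← Metric.cobounded_eq_cocompact, ← comap_norm_atTop, tendsto_comap_iff, tendsto_atTop]
  intro R
  set K : Set ℂ := Φ '' ({z : ℂ | 0 ≤ z.im} ∩ Metric.closedBall 0 R) with hK
  have hKc : IsCompact K := by
    refine ((isCompact_closedBall (0 : ℂ) R).inter_left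
      (isClosed_le continuous_const Complex.continuous_im)).image_of_continuousOn
      (hΦc.mono inter_subset_left)
  have hbK : b ∉ K := by
    rintro ⟨z, ⟨hz, -⟩, hzb⟩
    exact hΦb z hz hzb
  have hnhds : Kᶜ ∈ 𝓝 b := hKc.isClosed.isOpen_compl.mem_nhds hbK
  filter_upwards [mem_nhdsWithin_of_mem_nhds hnhds, self_mem_nhdsWithin] with p hpK hp
  obtain ⟨him, hΦp⟩ := inv_spec hsurj hp
  simp only [Function.comp_apply]
  by_contra hlt
  refine hpK ⟨_, ⟨him, ?_⟩, hΦp⟩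
  rw [mem_closedBall_zero_iff]
  exact (not_le.1 hlt).le

/-! ### Rays of the closed half-plane -/

/-- A ray `r ↦ r q` (`q ∈ ℍ̄ ∖ {0}`) tends to infinity within `ℍ̄`. [folklore] -/
theorem ray_tendsto {q : ℂ} (hq : 0 ≤ q.im) (hq0 : q ≠ 0) :
    Tendsto (fun r : ℝ => (r : ℂ) * q) atTop (cocompact ℂ ⊓ 𝓟 {z : ℂ | 0 ≤ z.im}) := by
  refine tendsto_inf.2 ⟨?_, ?_⟩
  · rw [← Metric.cobounded_eq_cocompact, ← comap_norm_atTop, tendsto_comap_iff]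
    have h : Tendsto (fun r : ℝ => r * ‖q‖) atTop atTop :=
      tendsto_id.atTop_mul_const (norm_pos_iff.2 hq0)
    refine h.congr' ?_
    filter_upwards [eventually_ge_atTop 0] with r hr
    simp [abs_of_nonneg hr]
  · refine tendsto_principal.2 ?_
    filter_upwards [eventually_ge_atTop 0] with r hr
    show 0 ≤ ((r : ℂ) * q).im
    simp only [Complex.mul_im, Complex.ofReal_re, Complex.ofReal_im, zero_mul, add_zero]
    exact mul_nonneg hr hq

/-- Along a ray of `ℍ̄`, `Φ (r q) → b` as `r → ∞`. [folklore] -/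
theorem ray_tendsto_pt (hΦinf : Tendsto Φ (cocompact ℂ ⊓ 𝓟 {z : ℂ | 0 ≤ z.im}) (𝓝 b)) {q : ℂ}
    (hq : 0 ≤ q.im) (hq0 : q ≠ 0) :
    Tendsto (fun r : ℝ => Φ ((r : ℂ) * q)) atTop (𝓝 b) :=
  hΦinf.comp (ray_tendsto hq hq0)

/-- Points of a ray through `q ∈ ℍ̄` with nonnegative parameter lie in `ℍ̄`. [folklore] -/
theorem ray_im_nonneg {q : ℂ} (hq : 0 ≤ q.im) {r : ℝ} (hr : 0 ≤ r) : 0 ≤ ((r : ℂ) * q).im := by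
  simp only [Complex.mul_im, Complex.ofReal_re, Complex.ofReal_im, zero_mul, add_zero]
  exact mul_nonneg hr hq

/-- Points of a ray through `q` in the open half-plane with positive parameter lie in the open
half-plane. [folklore] -/
theorem ray_im_pos {q : ℂ} (hq : 0 < q.im) {r : ℝ} (hr : 0 < r) : 0 < ((r : ℂ) * q).im := by
  simp only [Complex.mul_im, Complex.ofReal_re, Complex.ofReal_im, zero_mul, add_zero]
  exact mul_pos hr hq

/-- `r ↦ Φ (r q)` is continuous on `[0, ∞)` for `q ∈ ℍ̄`. [folklore] -/
theorem ray_continuousOn (hΦc : ContinuousOn Φ {z : ℂ | 0 ≤ z.im}) {q : ℂ} (hq : 0 ≤ q.im) :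
    ContinuousOn (fun r : ℝ => Φ ((r : ℂ) * q)) (Ici 0) :=
  hΦc.comp (by fun_prop) fun r hr => ray_im_nonneg hq hr

/-- **The image of the segment `[0, s₀] · p` is a weak arc** from `Φ 0` to `Φ (s₀ p)`
(a point when `p = 0` or `s₀ = 0`). [folklore] -/
theorem arcs_segment (hΦc : ContinuousOn Φ {z : ℂ | 0 ≤ z.im}) (hinj : InjOn Φ {z : ℂ | 0 ≤ z.im})
    {p : ℂ} (hp : 0 ≤ p.im) {s₀ : ℝ} (hs₀ : 0 ≤ s₀) (h : p ≠ 0 ∨ s₀ = 0) :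
    (Φ (((0 : ℝ) : ℂ) * p) = Φ ((s₀ : ℂ) * p) ∧
        (fun s : ℝ => Φ ((s : ℂ) * p)) '' Icc 0 s₀ = {Φ (((0 : ℝ) : ℂ) * p)}) ∨
      ∃ γ : Path (Φ (((0 : ℝ) : ℂ) * p)) (Φ ((s₀ : ℂ) * p)), Injective γ ∧
        range γ = (fun s : ℝ => Φ ((s : ℂ) * p)) '' Icc 0 s₀ := by
  refine arcs_of_continuousOn_injOn (f := fun s : ℝ => Φ ((s : ℂ) * p)) hs₀
    ((ray_continuousOn hΦc hp).mono Icc_subset_Ici_self) ?_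
  rcases h with hp0 | rfl
  · intro s hs t ht hst
    have h1 := hinj (ray_im_nonneg hp hs.1) (ray_im_nonneg hp ht.1) hst
    exact_mod_cast mul_right_cancel₀ hp0 h1
  · rw [Icc_self]
    exact injOn_singleton _ _

/-- **The image of the closed ray `[r₀, ∞] · q` is an arc** from `Φ (r₀ q)` to `b`
(`q ∈ ℍ̄ ∖ {0}`, `r₀ > 0`), parametrised by `t ↦ Φ ((r₀ / (1 - t)) q)` on `[0, 1)` and `1 ↦ b`.
[folklore] -/
theorem arcs_ray (hΦc : ContinuousOn Φ {z : ℂ | 0 ≤ z.im}) (hinj : InjOn Φ {z : ℂ | 0 ≤ z.im})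
    (hΦb : ∀ z : ℂ, 0 ≤ z.im → Φ z ≠ b)
    (hΦinf : Tendsto Φ (cocompact ℂ ⊓ 𝓟 {z : ℂ | 0 ≤ z.im}) (𝓝 b)) {q : ℂ} (hq : 0 ≤ q.im)
    (hq0 : q ≠ 0) {r₀ : ℝ} (hr₀ : 0 < r₀) :
    ∃ γ : Path (Φ ((r₀ : ℂ) * q)) b, Injective γ ∧
      range γ = (fun r : ℝ => Φ ((r : ℂ) * q)) '' Ici r₀ ∪ {b} := by
  classical
  set f : ℝ → ℂ := fun t => if t < 1 then Φ (((r₀ / (1 - t) : ℝ) : ℂ) * q) else b with hf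
  have hf0 : f 0 = Φ ((r₀ : ℂ) * q) := by simp [hf]
  have hf1 : f 1 = b := by simp [hf]
  have hflt : ∀ {t : ℝ}, t < 1 → f t = Φ (((r₀ / (1 - t) : ℝ) : ℂ) * q) := fun ht => if_pos ht
  have hpar : ∀ {t : ℝ}, t < 1 → 0 < r₀ / (1 - t) := fun ht => div_pos hr₀ (sub_pos.2 ht)
  -- continuity on `[0, 1]`
  have hg : ContinuousOn (fun t : ℝ => Φ (((r₀ / (1 - t) : ℝ) : ℂ) * q)) (Iio 1) := by
    refine hΦc.comp ?_ fun t ht => ray_im_nonneg hq (hpar ht).le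
    refine ((Complex.continuous_ofReal.comp_continuousOn ?_).mul continuousOn_const)
    exact continuousOn_const.div (continuousOn_const.sub continuousOn_id)
      fun t ht => (sub_pos.2 (show t < 1 from ht)).ne'
  have hlim : Tendsto f (𝓝[<] (1 : ℝ)) (𝓝 b) := by
    have h1 : Tendsto (fun t : ℝ => 1 - t) (𝓝[<] (1 : ℝ)) (𝓝[>] 0) := by
      refine tendsto_nhdsWithin_iff.2 ⟨?_, ?_⟩
      · have : Tendsto (fun t : ℝ => 1 - t) (𝓝 1) (𝓝 (1 - 1)) :=
          (continuous_const.sub continuous_id).tendsto 1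
        rw [sub_self] at this
        exact this.mono_left nhdsWithin_le_nhds
      · filter_upwards [self_mem_nhdsWithin] with t ht
        exact sub_pos.2 (mem_Iio.1 ht)
    have h2 : Tendsto (fun t : ℝ => r₀ / (1 - t)) (𝓝[<] (1 : ℝ)) atTop := by
      simp_rw [div_eq_mul_inv]
      exact (tendsto_inv_nhdsGT_zero.comp h1).const_mul_atTop hr₀
    have h3 := (ray_tendsto_pt hΦinf hq hq0).comp h2
    refine h3.congr' ?_
    filter_upwards [self_mem_nhdsWithin] with t ht
    simp only [Function.comp_apply, hflt (mem_Iio.1 ht)]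
  have hcont : ContinuousOn f (Icc 0 1) := by
    intro t ht
    rcases ht.2.lt_or_eq with hlt | rfl
    · have hev : f =ᶠ[𝓝 t] fun t : ℝ => Φ (((r₀ / (1 - t) : ℝ) : ℂ) * q) := by
        filter_upwards [Iio_mem_nhds hlt] with u hu
        exact hflt hu
      exact ((hg.continuousAt (Iio_mem_nhds hlt)).congr_of_eventuallyEq hev).continuousWithinAt
    · have h' : ContinuousWithinAt f (Iic 1) 1 := by
        rw [← continuousWithinAt_Iio_iff_Iic, ContinuousWithinAt, hf1]
        exact hlim
      exact h'.mono Icc_subset_Iic_self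
  -- injectivity on `[0, 1]`
  have hinj' : InjOn f (Icc 0 1) := by
    intro s hs t ht hst
    rcases hs.2.lt_or_eq with hs1 | rfl <;> rcases ht.2.lt_or_eq with ht1 | rfl
    · rw [hflt hs1, hflt ht1] at hst
      have h1 := hinj (ray_im_nonneg hq (hpar hs1).le) (ray_im_nonneg hq (hpar ht1).le) hst
      have h2 : ((r₀ / (1 - s) : ℝ) : ℂ) = ((r₀ / (1 - t) : ℝ) : ℂ) := mul_right_cancel₀ hq0 h1
      have h3 : r₀ / (1 - s) = r₀ / (1 - t) := by exact_mod_cast h2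
      rw [div_eq_div_iff (sub_pos.2 hs1).ne' (sub_pos.2 ht1).ne'] at h3
      nlinarith
    · rw [hflt hs1, hf1] at hst
      exact absurd hst (hΦb _ (ray_im_nonneg hq (hpar hs1).le))
    · rw [hflt ht1, hf1] at hst
      exact absurd hst.symm (hΦb _ (ray_im_nonneg hq (hpar ht1).le))
    · rfl
  -- the trace
  have himage : f '' Icc 0 1 = (fun r : ℝ => Φ ((r : ℂ) * q)) '' Ici r₀ ∪ {b} := by
    ext x
    simp only [mem_image, mem_Icc, mem_union, mem_Ici, mem_singleton_iff]
    constructor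
    · rintro ⟨t, ⟨ht0, ht1⟩, rfl⟩
      rcases ht1.lt_or_eq with hlt | rfl
      · left
        refine ⟨r₀ / (1 - t), ?_, (hflt hlt).symm⟩
        rw [le_div_iff₀ (sub_pos.2 hlt)]
        nlinarith
      · exact Or.inr hf1
    · rintro (⟨r, hr, rfl⟩ | rfl)
      · have hr' : 0 < r := hr₀.trans_le hr
        refine ⟨1 - r₀ / r, ⟨?_, ?_⟩, ?_⟩
        · rw [sub_nonneg, div_le_one hr']; exact hr
        · have : 0 < r₀ / r := div_pos hr₀ hr'
          linarith
        · have hlt : 1 - r₀ / r < 1 := by have : 0 < r₀ / r := div_pos hr₀ hr'; linarith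
          rw [hflt hlt, sub_sub_cancel, div_div_cancel₀ hr₀.ne']
      · exact ⟨1, ⟨zero_le_one, le_rfl⟩, hf1⟩
  rcases arcs_of_continuousOn_injOn zero_le_one hcont hinj' with ⟨h, -⟩ | ⟨γ, hγ, hrange⟩
  · rw [hf0, hf1] at h
    exact absurd h (hΦb _ (ray_im_nonneg hq hr₀.le))
  · refine ⟨γ.cast hf0.symm hf1.symm, hγ, ?_⟩
    rw [← himage, ← hrange]
    rfl

/-! ### The fallback arc `{a, b} ∪ Φ(i ℝ₊)` -/

/-- **The fallback attachment is a simple arc.** The set `{a, b} ∪ Φ (i · (0, ∞))` is the range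
of an injective curve from `a` to `b` whose other points lie in `D`: the image of the segment
`i · [0, 1]` glued to the image of the closed ray `i · [1, ∞]`. [folklore] -/
theorem fallback_curve (hab : a ≠ b) (hΦc : ContinuousOn Φ {z : ℂ | 0 ≤ z.im})
    (hinj : InjOn Φ {z : ℂ | 0 ≤ z.im}) (hΦ0 : Φ 0 = a) (hΦD : ∀ z : ℂ, 0 < z.im → Φ z ∈ D)
    (hΦb : ∀ z : ℂ, 0 ≤ z.im → Φ z ≠ b)
    (hΦinf : Tendsto Φ (cocompact ℂ ⊓ 𝓟 {z : ℂ | 0 ≤ z.im}) (𝓝 b)) :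
    ∃ c : Literature.Probability.RandomPlanarGeometry.Curve ℂ, Injective c ∧ c.source = a ∧
      c.target = b ∧ (∀ t, c t = a ∨ c t = b ∨ c t ∈ D) ∧
      range c = {a, b} ∪ ((fun y : ℝ => Φ (Complex.I * (y : ℂ))) '' Ioi 0) := by
  have hI : 0 ≤ Complex.I.im := by simp
  have h0 : Φ (((0 : ℝ) : ℂ) * Complex.I) = a := by rw [Complex.ofReal_zero, zero_mul, hΦ0]
  have h1 := arcs_segment hΦc hinj hI zero_le_one (Or.inl Complex.I_ne_zero)
  have h2 := arcs_ray hΦc hinj hΦb hΦinf hI Complex.I_ne_zero zero_lt_one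
  rw [Complex.ofReal_one] at h1 h2
  -- the two pieces meet only at `Φ i`
  have hmeet : (fun s : ℝ => Φ ((s : ℂ) * Complex.I)) '' Icc 0 1 ∩
      ((fun r : ℝ => Φ ((r : ℂ) * Complex.I)) '' Ici 1 ∪ {b}) ⊆ {Φ ((1 : ℂ) * Complex.I)} := by
    rintro x ⟨⟨s, hs, rfl⟩, hx⟩
    rcases hx with ⟨r, hr, hrs⟩ | hxb
    · have h := hinj (ray_im_nonneg hI (zero_le_one.trans hr)) (ray_im_nonneg hI hs.1) hrs
      have h' : (r : ℂ) = s := mul_right_cancel₀ Complex.I_ne_zero h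
      have h'' : r = s := by exact_mod_cast h'
      have hs1 : s = 1 := le_antisymm hs.2 (h'' ▸ hr)
      rw [mem_singleton_iff]
      simp only [hs1, Complex.ofReal_one]
    · exact absurd hxb (hΦb _ (ray_im_nonneg hI hs.1))
  have h3 := arcs_append h1 (Or.inr h2) hmeet
  rw [h0] at h3
  obtain ⟨c, hc, hcs, hct, hrange⟩ := arcs_exists_curve hab h3
  -- identification of the trace
  have htrace : (fun s : ℝ => Φ ((s : ℂ) * Complex.I)) '' Icc 0 1 ∪
      ((fun r : ℝ => Φ ((r : ℂ) * Complex.I)) '' Ici 1 ∪ {b}) =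
      {a, b} ∪ ((fun y : ℝ => Φ (Complex.I * (y : ℂ))) '' Ioi 0) := by
    ext x
    simp only [mem_union, mem_image, mem_Icc, mem_Ici, mem_singleton_iff, mem_insert_iff, mem_Ioi]
    constructor
    · rintro (⟨s, ⟨hs0, hs1⟩, rfl⟩ | ⟨r, hr, rfl⟩ | rfl)
      · rcases hs0.eq_or_lt with rfl | hpos
        · exact Or.inl (Or.inl h0)
        · exact Or.inr ⟨s, hpos, by rw [mul_comm]⟩
      · exact Or.inr ⟨r, zero_lt_one.trans_le hr, by rw [mul_comm]⟩
      · exact Or.inl (Or.inr rfl)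
    · rintro ((rfl | rfl) | ⟨y, hy, rfl⟩)
      · exact Or.inl ⟨0, ⟨le_rfl, zero_le_one⟩, h0⟩
      · exact Or.inr (Or.inr rfl)
      · rcases le_or_gt y 1 with hy1 | hy1
        · exact Or.inl ⟨y, ⟨hy.le, hy1⟩, by rw [mul_comm]⟩
        · exact Or.inr (Or.inl ⟨y, hy1.le, by rw [mul_comm]⟩)
  refine ⟨c, hc, hcs, hct, fun t => ?_, by rw [hrange, htrace]⟩
  have ht : c t ∈ range c := ⟨t, rfl⟩
  rw [hrange] at ht
  simp only [mem_union, mem_image, mem_Icc, mem_Ici, mem_singleton_iff] at ht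
  rcases ht with ⟨s, ⟨hs0, -⟩, hs⟩ | ⟨r, hr, hrx⟩ | hb
  · rcases hs0.eq_or_lt with rfl | hpos
    · exact Or.inl (hs ▸ h0.symm ▸ rfl)
    · exact Or.inr (Or.inr (hs ▸ hΦD _ (ray_im_pos (by simp) hpos)))
  · exact Or.inr (Or.inr (hrx ▸ hΦD _ (ray_im_pos (by simp) (zero_lt_one.trans_le hr))))
  · exact Or.inr (Or.inl hb)

end Summit.CriticalPhenomena.SAWScalingLimit.Theorems
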